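import Mathlib.RingTheory.RegularLocalRing.Defs
import Mathlib.Algebra.CharP.Algebra
import Literature.AlgebraicGeometry.Resolution.RegularLocalRingsProofs
import Literature.RingTheory.TightClosure.RegularTightlyClosed
import Summits.ResolutionOfSingularities.ResolutionOfSingularities.Theorems.FrobeniusLadderFInjectiveMacaulayficationFedderCriterion
import HarnessLib

/-!
# Monomials in a regular system of parameters lie outside the Frobenius power `𝔪^[p]`
# (BED Ω₁ GLOBAL PATCH, F6: the algebra under the direct Fedder tests of the pencil charts over the regular base `𝒪_{X̃₂,x̃}`;
# `g15/F6-ARCHITECTURE-v2.md` §2; crux `FInjectiveMacaulayfication` stmt-ResolutionOfSingularities-15315, chain w45a; seat res-L1-w45a-stub-3 g15)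

[OURS · L1 W4.5a] Support file (`--supports stmt-ResolutionOfSingularities-15315 --as helper`); theorems only; GENERIC commutative algebra; no named fact;
NOT a statement of any manuscript; nothing of the crux is proved. AI-written (AI review is weaker than expert review).

Let `(R, 𝔪)` be a regular local ring of prime characteristic `p` and `s` a regular system of parameters (a list of `dim R` generators of `𝔪`).
* ★ `prod_pow_sub_one_not_mem_frobeniusPower` — `∏ sᵢ^(p-1) ∉ 𝔪^[p]` (induction on `dim R`: Kunz's flat colon ✓ `mem_frobeniusPower_colon_of_isRegularLocalRing`
  gives `∏_{i≥2} sᵢ^(p-1) ∈ (s₂,…)^[p] + (s₁)`, then pass to the regular local ring `R/(s₁)`);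
* `head_not_mem_ofList_tail`, `quotient_head_isRegularLocalRing`, `isPrime_ofList_tail` — bookkeeping on regular systems of parameters (Matsumura 14.2).
These are the non-membership facts that ✓ `Fedder.fedder_criterion` turns into the crux's stalk clause for hypersurfaces `R/(f)`.
[cite: HunekeSwanson2006, proof of Thm. 13.1.2 (6); Matsumura1987, Thm. 14.2; Fedder1983, Prop. 1.7]
-/

set_option linter.dupNamespace false

namespace Summit.ResolutionOfSingularities.ResolutionOfSingularities.Theorems.FInjectiveMacaulayfication.SopFrobeniusPower

open IsLocalRing Literature.RingTheory.TightClosure Literature.AlgebraicGeometry.Resolution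

universe u

variable (p : ℕ) [Fact p.Prime]

/-- `𝔪^[p]` of the ideal generated by a list is generated by the `p`-th powers of the list. [folklore] -/
theorem frobeniusPower_ofList {R : Type u} [CommRing R] [CharP R p] (s : List R) :
    frobeniusPower p (Ideal.ofList s) = Ideal.ofList (s.map fun x => x ^ p) := by
  have h := frobeniusPower_span (R := R) p 1 {r | r ∈ s}
  rw [pow_one] at h
  rw [Ideal.ofList, Ideal.ofList, h]
  congr 1
  ext y
  simp only [Set.mem_image, Set.mem_setOf_eq, List.mem_map]

/-- For a list of `dim R` generators of the maximal ideal of a regular local ring, the associated finset has `dim R` elements. [cite: Matsumura1987, Thm. 14.2] -/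
theorem card_toFinset_eq {R : Type u} [CommRing R] [IsRegularLocalRing R] [DecidableEq R] (s : List R)
    (hspan : Ideal.ofList s = maximalIdeal R) (hlen : (s.length : WithBot ℕ∞) = ringKrullDim R) :
    (s.toFinset.card : WithBot ℕ∞) = ringKrullDim R := by
  apply le_antisymm (le_of_le_of_eq (Nat.cast_le.mpr s.toFinset_card_le) hlen)
  rw [← (isRegularLocalRing_iff R).mp ‹_›, Nat.cast_le, ← hspan, Ideal.ofList, ← List.coe_toFinset s, ← Set.ncard_coe_finset s.toFinset]
  exact Submodule.spanFinrank_span_le_ncard_of_finite s.toFinset.finite_toSet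

/-- In a regular local ring, a list of `dim R` generators of `𝔪` has no redundant member: `x ∉ (t)` for `𝔪 = (x) + (t)`. [cite: Matsumura1987, Thm. 14.2] -/
theorem head_not_mem_ofList_tail {R : Type u} [CommRing R] [IsRegularLocalRing R] (x : R) (t : List R)
    (hspan : Ideal.ofList (x :: t) = maximalIdeal R) (hlen : ((x :: t).length : WithBot ℕ∞) = ringKrullDim R) :
    x ∉ Ideal.ofList t := by
  classical
  intro hx
  have heq : Ideal.ofList t = maximalIdeal R := by
    rw [← hspan, Ideal.ofList_cons]
    refine le_antisymm le_sup_right (sup_le ?_ le_rfl)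
    rw [Ideal.span_singleton_le_iff_mem]; exact hx
  have hle : (maximalIdeal R).spanFinrank ≤ t.length := by
    rw [← heq, Ideal.ofList, ← List.coe_toFinset]
    refine (Submodule.spanFinrank_span_le_ncard_of_finite t.toFinset.finite_toSet).trans ?_
    rw [Set.ncard_coe_finset]
    exact List.toFinset_card_le t
  have hreg := (isRegularLocalRing_iff R).mp ‹_›
  have h1 : ((maximalIdeal R).spanFinrank : WithBot ℕ∞) = ((x :: t).length : WithBot ℕ∞) := by rw [hreg, hlen]
  have h2 : (maximalIdeal R).spanFinrank = (x :: t).length := by exact_mod_cast h1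
  rw [List.length_cons] at h2
  omega

/-- The quotient of a regular local ring by the head of a regular system of parameters is regular of dimension one less. [cite: Matsumura1987, Thm. 14.2] -/
theorem quotient_head_isRegularLocalRing {R : Type u} [CommRing R] [IsRegularLocalRing R] (x : R) (t : List R)
    (hspan : Ideal.ofList (x :: t) = maximalIdeal R) (hlen : ((x :: t).length : WithBot ℕ∞) = ringKrullDim R) :
    IsRegularLocalRing (R ⧸ Ideal.span {x}) ∧ ringKrullDim (R ⧸ Ideal.span {x}) + 1 = ringKrullDim R := by
  classical
  have mem : ((x :: t).toFinset : Set R) ⊆ maximalIdeal R := by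
    intro y hy
    rw [← hspan]
    exact Ideal.subset_span (by simpa using hy)
  have card := card_toFinset_eq (x :: t) hspan hlen
  have sub : ({x} : Finset R) ⊆ (x :: t).toFinset := by simp
  have hx : (({x} : Finset R) : Set R) ⊆ maximalIdeal R := (Finset.coe_subset.mpr sub).trans mem
  have h0 : ∃ T : Finset R, {x} ⊆ T ∧ (T.card : WithBot ℕ∞) = ringKrullDim R ∧ Ideal.span (T : Set R) = maximalIdeal R :=
    ⟨(x :: t).toFinset, sub, card, by rw [← hspan, Ideal.ofList, List.coe_toFinset]⟩
  have h := ((quotient_isRegularLocalRing_tfae R {x} hx).out 0 2).mp h0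
  rw [Finset.coe_singleton, Finset.card_singleton, Nat.cast_one] at h
  exact h

/-- The tail of a regular system of parameters generates a prime ideal (the quotient is regular local, hence a domain). [cite: Matsumura1987, Thms. 14.2, 14.3] -/
theorem isPrime_ofList_tail {R : Type u} [CommRing R] [IsRegularLocalRing R] (x : R) (t : List R)
    (hspan : Ideal.ofList (x :: t) = maximalIdeal R) (hlen : ((x :: t).length : WithBot ℕ∞) = ringKrullDim R) :
    (Ideal.ofList t).IsPrime := by
  classical
  have mem : ((x :: t).toFinset : Set R) ⊆ maximalIdeal R := by
    intro y hy; rw [← hspan]; exact Ideal.subset_span (by simpa using hy)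
  have card := card_toFinset_eq (x :: t) hspan hlen
  have sub : t.toFinset ⊆ (x :: t).toFinset := fun y hy => by
    rw [List.mem_toFinset] at hy ⊢; exact List.mem_cons_of_mem x hy
  have ht : ((t.toFinset : Finset R) : Set R) ⊆ maximalIdeal R := (Finset.coe_subset.mpr sub).trans mem
  have h0 : ∃ T : Finset R, t.toFinset ⊆ T ∧ (T.card : WithBot ℕ∞) = ringKrullDim R ∧ Ideal.span (T : Set R) = maximalIdeal R :=
    ⟨(x :: t).toFinset, sub, card, by rw [← hspan, Ideal.ofList, List.coe_toFinset]⟩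
  obtain ⟨hreg, -⟩ := ((quotient_isRegularLocalRing_tfae R t.toFinset ht).out 0 2).mp h0
  have hI' : Ideal.span ((t.toFinset : Finset R) : Set R) = Ideal.ofList t := by rw [Ideal.ofList, List.coe_toFinset]
  rw [hI'] at hreg
  haveI := @isDomain_of_isRegularLocalRing _ _ hreg
  exact (Ideal.Quotient.isDomain_iff_prime _).mp ‹_›

/-- ★ **`∏ sᵢ^(p-1) ∉ 𝔪^[p]` for a regular system of parameters `s` of a regular local ring of characteristic `p`.**
[cite: HunekeSwanson2006, proof of Thm. 13.1.2 (6); Matsumura1987, Thm. 14.2] -/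
theorem prod_pow_sub_one_not_mem_frobeniusPower :
    ∀ (d : ℕ) (R : Type u) [CommRing R] [IsRegularLocalRing R] [CharP R p] (s : List R),
      Ideal.ofList s = maximalIdeal R → (s.length : WithBot ℕ∞) = ringKrullDim R → s.length = d →
      (s.map fun x => x ^ (p - 1)).prod ∉ frobeniusPower p (maximalIdeal R) := by
  intro d
  induction d with
  | zero =>
    intro R _ _ _ s hspan _ hlen h
    rw [List.length_eq_zero_iff] at hlen
    subst hlen
    rw [List.map_nil, List.prod_nil, ← hspan, Ideal.ofList_nil] at h
    have h1 : (1 : R) ∈ (⊥ : Ideal R) := frobeniusPower_le (Fact.out : p.Prime).ne_zero ⊥ h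
    rw [Ideal.mem_bot] at h1
    exact one_ne_zero h1
  | succ d ih =>
    intro R _ _ _ s hspan hlen hd h
    cases s with
    | nil => simp at hd
    | cons x t =>
    haveI : IsDomain R := isDomain_of_isRegularLocalRing R
    have hp0 : p ≠ 0 := (Fact.out : p.Prime).ne_zero
    set I : Ideal R := Ideal.ofList t with hI
    set m : R := (t.map fun y => y ^ (p - 1)).prod with hm
    rw [List.map_cons, List.prod_cons] at h
    -- `𝔪^[p] = (x^p) + I^[p]`
    have hfrob : frobeniusPower p (maximalIdeal R) = Ideal.span {x ^ p} ⊔ frobeniusPower p I := by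
      rw [← hspan, frobeniusPower_ofList, hI, frobeniusPower_ofList, List.map_cons, Ideal.ofList_cons]
    rw [hfrob, Ideal.mem_span_singleton_sup] at h
    obtain ⟨a, b, hb, hab⟩ := h
    have hb' : b = x ^ (p - 1) * m - a * x ^ p := by rw [hm]; linear_combination hab
    have hp1 : x ^ p = x * x ^ (p - 1) := by
      rw [← pow_succ']; congr 1; exact (Nat.succ_pred_eq_of_ne_zero hp0).symm
    -- `x^p · (m - a x) ∈ I^[p]`
    have hcol : (m - a * x) * x ^ p ^ 1 ∈ frobeniusPower (p ^ 1) I := by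
      rw [pow_one]
      have : (m - a * x) * x ^ p = x * b := by linear_combination m * hp1 - x * hb'
      rw [this]
      exact Ideal.mul_mem_left _ _ hb
    have hcol' := mem_frobeniusPower_colon_of_isRegularLocalRing p (I := I) (x := x) (c := m - a * x) 1 hcol
    rw [pow_one] at hcol'
    -- `(I : x) = I`: `I` is prime and `x ∉ I`
    have hxI : x ∉ I := head_not_mem_ofList_tail x t hspan hlen
    have hIprime : I.IsPrime := isPrime_ofList_tail x t hspan hlen
    have hcolon : I.colon {x} = I := by
      refine le_antisymm ?_ Ideal.le_colon
      intro c hc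
      rw [Submodule.mem_colon_singleton, smul_eq_mul] at hc
      exact (hIprime.mem_or_mem hc).resolve_right hxI
    rw [hcolon] at hcol'
    -- pass to `R/(x)`
    obtain ⟨hreg, hdim⟩ := quotient_head_isRegularLocalRing x t hspan hlen
    haveI := hreg
    haveI : CharP (R ⧸ Ideal.span {x}) p := CharP.of_ringHom_of_ne_zero (Ideal.Quotient.mk (Ideal.span {x})) p hp0
    set π := Ideal.Quotient.mk (Ideal.span {x}) with hπ
    have hπx : π x = 0 := Ideal.Quotient.eq_zero_iff_mem.mpr (Ideal.mem_span_singleton_self x)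
    have hspan' : Ideal.ofList (t.map π) = maximalIdeal (R ⧸ Ideal.span {x}) := by
      rw [maximalIdeal_quotient_eq_map, ← hspan, Ideal.map_ofList, List.map_cons, Ideal.ofList_cons, hπx,
        Ideal.span_singleton_eq_bot.mpr rfl, bot_sup_eq]
    have hlen' : ((t.map π).length : WithBot ℕ∞) = ringKrullDim (R ⧸ Ideal.span {x}) := by
      rw [List.length_map]
      have hreg' := (isRegularLocalRing_iff (R ⧸ Ideal.span {x})).mp hreg
      rw [← hreg'] at hdim ⊢
      rw [← hlen, List.length_cons] at hdim
      have hnat : (maximalIdeal (R ⧸ Ideal.span {x})).spanFinrank + 1 = t.length + 1 := by exact_mod_cast hdim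
      have : (maximalIdeal (R ⧸ Ideal.span {x})).spanFinrank = t.length := by omega
      rw [this]
    have hd' : (t.map π).length = d := by rw [List.length_map]; simpa using hd
    refine ih (R ⧸ Ideal.span {x}) (t.map π) hspan' hlen' hd' ?_
    have himage : ((t.map π).map fun y => y ^ (p - 1)).prod = π m := by
      simp only [hm, map_list_prod, List.map_map, Function.comp_def, map_pow]
    rw [himage, ← hspan', ← Ideal.map_ofList]
    have hfm := Fedder.frobeniusPower_map p π 1 I
    rw [pow_one] at hfm
    rw [hfm]
    have : π m = π (m - a * x) := by rw [map_sub, map_mul, hπx, mul_zero, sub_zero]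
    rw [this]
    exact Ideal.mem_map_of_mem π hcol'


/-! ## Monomials in a regular system of parameters -/

/-- The monomial `∏ᵢ s[i]^(e i)` in the members of a list `s` (exponents indexed by position). [OURS bookkeeping] -/
theorem prod_pow_eq_map_prod {R : Type u} [CommRing R] (s : List R) (f : R → R) :
    (∏ i : Fin s.length, f s[i]) = (s.map f).prod := by
  rw [← List.prod_ofFn]
  simp only [Fin.getElem_fin]
  rw [List.ofFn_getElem_eq_map]

/-- `(∏ s[i]^(e i)) · (∏ s[i]^(e' i)) = ∏ s[i]^(e i + e' i)`. [folklore] -/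
theorem prod_pow_mul_prod_pow {R : Type u} [CommRing R] (s : List R) (e e' : ℕ → ℕ) :
    (∏ i : Fin s.length, s[i] ^ e i) * (∏ i : Fin s.length, s[i] ^ e' i) = ∏ i : Fin s.length, s[i] ^ (e i + e' i) := by
  rw [← Finset.prod_mul_distrib]
  refine Finset.prod_congr rfl fun i _ => ?_
  rw [pow_add]

/-- ★ **A monomial `∏ s[i]^(e i)` with all exponents `≤ p - 1` in a regular system of parameters `s` lies outside `𝔪^[p]`.**
[cite: HunekeSwanson2006, proof of Thm. 13.1.2 (6); Matsumura1987, Thm. 14.2] -/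
theorem monomial_not_mem_frobeniusPower {R : Type u} [CommRing R] [IsRegularLocalRing R] [CharP R p] (s : List R)
    (hspan : Ideal.ofList s = maximalIdeal R) (hlen : (s.length : WithBot ℕ∞) = ringKrullDim R)
    (e : ℕ → ℕ) (he : ∀ i, e i ≤ p - 1) :
    (∏ i : Fin s.length, s[i] ^ e i) ∉ frobeniusPower p (maximalIdeal R) := by
  intro h
  have hmul : (∏ i : Fin s.length, s[i] ^ e i) * (∏ i : Fin s.length, s[i] ^ (p - 1 - e i)) ∈ frobeniusPower p (maximalIdeal R) :=
    Ideal.mul_mem_right _ _ h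
  rw [prod_pow_mul_prod_pow s e (fun i => p - 1 - e i)] at hmul
  have heq : (∏ i : Fin s.length, s[i] ^ (e i + (p - 1 - e i))) = (s.map fun x => x ^ (p - 1)).prod := by
    rw [← prod_pow_eq_map_prod]
    refine Finset.prod_congr rfl fun i _ => ?_
    rw [Nat.add_sub_cancel' (he i)]
  rw [heq] at hmul
  exact prod_pow_sub_one_not_mem_frobeniusPower p s.length R s hspan hlen rfl hmul

/-- ★ **`u · ∏ s[i]^(e i) + G ∉ 𝔪^[p]`** for a unit `u`, exponents `e i ≤ p - 1`, and any `G` with `G · ∏ s[i]^(p-1-e i) ∈ 𝔪^[p]` (e.g. a sum of multiples of monomials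
`∏ s[i]^(e' i)` with `e' ≰ e`). The «minimal small monomial» form of Fedder's test. [cite: Fedder1983, Prop. 1.7; HunekeSwanson2006, proof of Thm. 13.1.2 (6)] -/
theorem unit_mul_monomial_add_not_mem_frobeniusPower {R : Type u} [CommRing R] [IsRegularLocalRing R] [CharP R p] (s : List R)
    (hspan : Ideal.ofList s = maximalIdeal R) (hlen : (s.length : WithBot ℕ∞) = ringKrullDim R)
    (e : ℕ → ℕ) (he : ∀ i, e i ≤ p - 1) (u : R) (hu : IsUnit u) (G : R)
    (hG : G * (∏ i : Fin s.length, s[i] ^ (p - 1 - e i)) ∈ frobeniusPower p (maximalIdeal R)) :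
    u * (∏ i : Fin s.length, s[i] ^ e i) + G ∉ frobeniusPower p (maximalIdeal R) := by
  intro h
  have hmul : (u * (∏ i : Fin s.length, s[i] ^ e i) + G) * (∏ i : Fin s.length, s[i] ^ (p - 1 - e i)) ∈ frobeniusPower p (maximalIdeal R) :=
    Ideal.mul_mem_right _ _ h
  rw [add_mul, mul_assoc, prod_pow_mul_prod_pow s e (fun i => p - 1 - e i)] at hmul
  have h1 : u * (∏ i : Fin s.length, s[i] ^ (e i + (p - 1 - e i))) ∈ frobeniusPower p (maximalIdeal R) := by
    have := Ideal.sub_mem _ hmul hG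
    rwa [add_sub_cancel_right] at this
  have h2 := Ideal.mul_mem_left _ (↑hu.unit⁻¹ : R) h1
  rw [← mul_assoc, IsUnit.val_inv_mul, one_mul] at h2
  have heq : (∏ i : Fin s.length, s[i] ^ (e i + (p - 1 - e i))) = (s.map fun x => x ^ (p - 1)).prod := by
    rw [← prod_pow_eq_map_prod]
    refine Finset.prod_congr rfl fun i _ => ?_
    rw [Nat.add_sub_cancel' (he i)]
  rw [heq] at h2
  exact prod_pow_sub_one_not_mem_frobeniusPower p s.length R s hspan hlen rfl h2

omit [Fact p.Prime] in
/-- A monomial `∏ s[i]^(e i)` one of whose exponents is `≥ p` lies in `𝔪^[p]` (for `𝔪 = (s)`). [folklore] -/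
theorem monomial_mem_frobeniusPower_of_le {R : Type u} [CommRing R] [IsLocalRing R] [CharP R p] (s : List R)
    (hspan : Ideal.ofList s = maximalIdeal R) (e : ℕ → ℕ) (i₀ : Fin s.length) (hi₀ : p ≤ e i₀) :
    (∏ i : Fin s.length, s[i] ^ e i) ∈ frobeniusPower p (maximalIdeal R) := by
  rw [← Finset.mul_prod_erase Finset.univ (fun i : Fin s.length => s[i] ^ e i) (Finset.mem_univ i₀)]
  refine Ideal.mul_mem_right _ _ ?_
  obtain ⟨k, hk⟩ := Nat.exists_eq_add_of_le hi₀
  rw [hk, pow_add]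
  refine Ideal.mul_mem_right _ _ (pow_mem_frobeniusPower ?_)
  rw [← hspan]
  exact Ideal.subset_span (List.getElem_mem i₀.2)

/-- **`x ∈ 𝔪 ∖ 𝔪²` ⇒ `x^(p-1) ∉ 𝔪^[p]`** in a regular local ring of characteristic `p` (extend `x` to a regular system of parameters, Matsumura 14.2).
[cite: Matsumura1987, Thm. 14.2; HunekeSwanson2006, proof of Thm. 13.1.2 (6)] -/
theorem pow_sub_one_not_mem_frobeniusPower_of_not_mem_sq {R : Type u} [CommRing R] [IsRegularLocalRing R] [CharP R p] (x : R)
    (hx : x ∈ maximalIdeal R) (hx2 : x ∉ maximalIdeal R ^ 2) :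
    x ^ (p - 1) ∉ frobeniusPower p (maximalIdeal R) := by
  classical
  obtain ⟨T, hxT, hcard, hTspan⟩ := ((quotient_isRegularLocalRing_tfae R {x} (by simpa using hx)).out 1 0).mp
    (by simpa [← LinearMap.mem_ker, Ideal.mem_toCotangent_ker] using hx2)
  set s := T.toList with hs
  have hspan : Ideal.ofList s = maximalIdeal R := by simpa [Ideal.ofList, hs] using hTspan
  have hlen : (s.length : WithBot ℕ∞) = ringKrullDim R := by rw [hs, Finset.length_toList, hcard]
  have hxs : x ∈ s := by rw [hs, Finset.mem_toList]; exact hxT (Finset.mem_singleton_self x)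
  obtain ⟨i₀, hi₀, hsx⟩ := List.mem_iff_getElem.mp hxs
  have key := monomial_not_mem_frobeniusPower p s hspan hlen (fun i => if i = i₀ then p - 1 else 0)
    (fun i => by split_ifs <;> omega)
  have heq : (∏ i : Fin s.length, s[i] ^ (if (i : ℕ) = i₀ then p - 1 else 0)) = x ^ (p - 1) := by
    rw [Finset.prod_eq_single (⟨i₀, hi₀⟩ : Fin s.length)]
    · simp only [if_true, Fin.getElem_fin, hsx]
    · intro j _ hj
      have : (j : ℕ) ≠ i₀ := fun h => hj (Fin.ext h)
      rw [if_neg this, pow_zero]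
    · intro h; exact absurd (Finset.mem_univ _) h
  rw [heq] at key
  exact key

end Summit.ResolutionOfSingularities.ResolutionOfSingularities.Theorems.FInjectiveMacaulayfication.SopFrobeniusPower
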